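import Literature.Computability.Cryptography.HallgrenPostProcessor
import HarnessLib

/-!
# Hallgren's classical post-processor is correct on a good pair of samples

Topic `Computability/Cryptography`; the deterministic half of the success analysis of
`HallgrenPostProcessor.lean` (Jozsa 2003, §10, proof of Thm. 6 and step (c)). Fix an input `x`, an
output string `y` of the quantum core, and an abstract infrastructure `C : GiantStepCycle ι`
presenting the rational walk data of the instance `W.dOf x` (`C.toWalkData = O.toWalkData (W.dOf x)`),
with regulator `R = C.R` and grid period `S = N R`.

* `cU_lt` (`c_u < 2^{L_u}`); `keep_sound` — a kept candidate `sc` has `N/8 ≤ sc` and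
  `|sc/N − lR| ≤ τ` for an integer `l ≥ 1` (`τ = 2δ₀/N + E + 2η`, by `passesI_eq` and
  `GiantStepCycle.passes_sound`); `mem_cands_keep` (listed candidates are kept);
* **`exists_true_cand`** — if two units `u ≠ u'` of the same block length `L ≥ Lmin` carry the
  rounded harmonics `c_u ≈ kQ/S`, `c_{u'} ≈ lQ/S` of a coprime pair `1 ≤ k, l ≤ S` (`Q = 2^L ≥ 3S²`),
  then some listed candidate `sc` has `|sc − NR| < 1` (Jozsa's Lemma 2 through
  `exists_mem_numsOf_round`, kept by `passes_complete`);
* **`result_eq_floor_or_ceil`** — if some listed candidate is within `1` of `NR` (and `τ < 1/16`,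
  `N ≥ 16`), the answer `m = ⌊s⋆/N + 1/4⌋` of the least candidate `s⋆` is `⌊R⌋₊` or `⌈R⌉₊`.

Theorem file, no named facts.

## References

* R. Jozsa, arXiv:quant-ph/0302134 (2003), §10 (Thm. 6, Lemma 2, step (c)), §3 Prop. 2. [Jozsa2003]
* S. Hallgren, J. ACM 54 (2007), Art. 4, §4. [Hallgren2007]
-/

noncomputable section

open scoped Classical

namespace Literature.Computability.Cryptography

namespace HallgrenPost

open _root_.Computability Complexity PeriodFinding OFPostCF Polynomial Literature.Barriers.QuantumAdvantage IntWalkOps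
  GiantStepCycle

variable (q : Polynomial ℕ) {δ ι : Type} (O : IntWalkOps δ ι) (W : WalkParams δ)

/-- `c_u < 2^{L_u}`. [folklore] -/
theorem cU_lt (x y : List Bool) (u : ℕ) : cU q x y u < 2 ^ LofC q (coreLen x) u :=
  Nat.mod_lt _ (by positivity)

variable {O W}

/-- The tolerance of the check: `τ = 2δ₀/N + E + 2η`. [folklore] -/
def tol (C : GiantStepCycle ι) (W : WalkParams δ) (x : List Bool) : ℝ :=
  2 * ((W.δ₀ : ℝ) / (W.N x)) + C.Efin (W.s₀ x) (W.T x) (2 * W.M x) + 2 * C.η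

/-- **Kept candidates are sound**: `N/8 ≤ sc` and `|sc/N − lR| ≤ τ` with `l ≥ 1` once `τ < sc/N`.
[cite: Jozsa2003, §10 (c)] -/
theorem keep_sound (C : GiantStepCycle ι) {x : List Bool} (hC : C.toWalkData = O.toWalkData (W.dOf x)) (hN : 0 < (W.N x))
    {sc : ℤ} (hk : keep O W x sc = true) :
    ((W.N x) : ℤ) / 8 ≤ sc ∧ ∃ l : ℤ, |(sc : ℝ) / (W.N x) - l * C.R| ≤ tol C W x ∧ (tol C W x < (sc : ℝ) / (W.N x) → 1 ≤ l) := by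
  unfold keep at hk
  rw [passesI_eq C hC hN, decide_eq_true_eq] at hk
  obtain ⟨h8, hp⟩ := hk
  refine ⟨h8, ?_⟩
  obtain ⟨l, h1, h2⟩ := C.passes_sound hp
  simp only [Rat.cast_div, Rat.cast_intCast, Rat.cast_natCast] at h1 h2
  exact ⟨l, h1, h2⟩

/-- Listed candidates are kept. [folklore] -/
theorem mem_cands_keep {x y : List Bool} {sc : ℤ} (h : sc ∈ cands q O W x y) : keep O W x sc = true := by
  unfold cands at h
  simp only [List.mem_flatMap, List.mem_range] at h
  obtain ⟨u, -, u', -, hm⟩ := h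
  unfold pairCands at hm
  split_ifs at hm with hg
  · exact (List.mem_filter.1 hm).2
  · simp at hm

/-- **The true candidate is listed**: Jozsa's recovery on a good coprime pair of samples, kept by
the completeness of the check. [cite: Jozsa2003, §10 (Thm. 6, Lemma 2)] -/
theorem exists_true_cand (C : GiantStepCycle ι) {x y : List Bool} (hC : C.toWalkData = O.toWalkData (W.dOf x))
    (hN : 0 < (W.N x)) {u u' : ℕ} (hu : u < nU (ofPoly q) (coreLen x)) (hu' : u' < nU (ofPoly q) (coreLen x))
    (hL : LofC q (coreLen x) u = LofC q (coreLen x) u') (hLmin : W.Lmin (coreLen x) ≤ LofC q (coreLen x) u)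
    {k l : ℕ} (hS : 1 ≤ ((W.N x) : ℝ) * C.R) (hQ : 3 * (((W.N x) : ℝ) * C.R) ^ 2 ≤ (2 ^ LofC q (coreLen x) u : ℕ))
    (hk : 1 ≤ k) (hkS : (k : ℝ) ≤ (W.N x) * C.R) (hl : 1 ≤ l) (hlS : (l : ℝ) ≤ (W.N x) * C.R) (hcop : Nat.Coprime k l)
    (hc : |(cU q x y u : ℝ) - k * (2 ^ LofC q (coreLen x) u : ℕ) / ((W.N x) * C.R)| ≤ 1 / 2)
    (hd : |(cU q x y u' : ℝ) - l * (2 ^ LofC q (coreLen x) u : ℕ) / ((W.N x) * C.R)| ≤ 1 / 2)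
    -- adequacy of the walk and of the tolerances
    (hR8 : ((W.N x) : ℝ) / 8 + 1 ≤ (W.N x) * C.R) (hδ₀ : 8 * W.δ₀ ≤ (W.N x))
    (hreach : ∀ sc : ℤ, (sc : ℝ) ≤ (W.N x) * C.R + 1 →
      ((((sc : ℚ) / (W.N x) - (W.δ₀ : ℚ) / (W.N x) : ℚ)) : ℝ) ≤ (C.dbl (W.s₀ x) (W.T x)).2)
    (hM : C.Res (W.s₀ x) (W.T x) < (W.M x) * (C.L - 2 * C.η))
    (hΔ : 1 / ((W.N x) : ℝ) + C.Efin (W.s₀ x) (W.T x) (2 * W.M x) + 2 * C.η < (W.δ₀ : ℝ) / (W.N x))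
    (hLgap : (W.δ₀ : ℝ) / (W.N x) + C.Efin (W.s₀ x) (W.T x) (2 * W.M x) + C.η + 1 / (W.N x) < C.L) :
    ∃ sc ∈ cands q O W x y, |(sc : ℝ) - (W.N x) * C.R| < 1 := by
  set S : ℝ := ((W.N x) : ℝ) * C.R with hSdef
  set L := LofC q (coreLen x) u with hLdef
  set Q : ℕ := 2 ^ L with hQdef
  set c : ℕ := cU q x y u with hcdef
  set d : ℕ := cU q x y u' with hddef
  -- Jozsa's recovery through the numerators of `c/d`
  have hc' : |((c : ℤ) : ℝ) - k * Q / S| ≤ 1 / 2 := by simpa using hc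
  have hd' : |((d : ℤ) : ℝ) - l * Q / S| ≤ 1 / 2 := by simpa using hd
  have hdL : (d : ℤ).toNat < 2 ^ L := by
    rw [Int.toNat_natCast, hddef, hL]; exact cU_lt q x y u'
  obtain ⟨p, hp, hround⟩ := exists_mem_numsOf_round (s := L) hS hQ hk hkS hl hlS hcop hc' hd' hdL
  rw [Int.toNat_natCast, Int.toNat_natCast] at hp
  have hcpos : 0 < c := by
    have := IrrationalPeriod.sample_pos hS hQ hk hc'
    exact_mod_cast this
  -- the candidate
  set sc : ℤ := candOfNum Q c p with hscdef
  have hsc : (sc : ℝ) = round ((p : ℝ) * Q / c) := by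
    rw [hscdef, candOfNum_eq_round hcpos]
  have hclose1 : |(sc : ℝ) - S| < 1 := by rw [hsc, abs_sub_comm]; exact hround
  refine ⟨sc, ?_, hclose1⟩
  -- it is kept
  have hNr : (0 : ℝ) < (W.N x) := by exact_mod_cast hN
  have h8 : ((W.N x) : ℤ) / 8 ≤ sc := by
    have h1 : ((((W.N x) : ℤ) / 8 : ℤ) : ℝ) ≤ ((W.N x) : ℝ) / 8 := by
      have := Int.ediv_mul_le ((W.N x) : ℤ) (by norm_num : (8 : ℤ) ≠ 0)
      have h' : ((((W.N x) : ℤ) / 8 : ℤ) : ℝ) * 8 ≤ (W.N x) := by exact_mod_cast this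
      linarith
    have h2 : ((W.N x) : ℝ) / 8 ≤ sc := by
      rw [abs_lt] at hclose1; linarith [hclose1.1]
    exact_mod_cast h1.trans h2
  have hkeep : keep O W x sc = true := by
    unfold keep
    rw [passesI_eq C hC hN, decide_eq_true_eq]
    refine ⟨h8, ?_⟩
    have hscx : (W.δ₀ : ℚ) / (W.N x) ≤ (sc : ℚ) / (W.N x) := by
      refine div_le_div_of_nonneg_right ?_ (by positivity)
      have : (8 * W.δ₀ : ℤ) ≤ (W.N x) := by exact_mod_cast hδ₀
      have h8' : (((W.N x) : ℤ) / 8) * 8 ≤ (W.N x) := Int.ediv_mul_le _ (by norm_num)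
      have : (W.δ₀ : ℤ) ≤ ((W.N x) : ℤ) / 8 := by omega
      exact_mod_cast this.trans h8
    refine C.passes_complete (δ := 1 / (W.N x)) (l := 1) (W.s₀ x) hscx ?_ hM ?_ ?_ ?_
    · refine hreach sc ?_
      rw [abs_lt] at hclose1; linarith [hclose1.2]
    · have : (((sc : ℚ) / (W.N x) : ℚ) : ℝ) - (1 : ℤ) * C.R = ((sc : ℝ) - S) / (W.N x) := by
        push_cast; rw [hSdef]; field_simp
      rw [this, abs_div, abs_of_pos hNr, div_le_div_iff_of_pos_right hNr]
      exact hclose1.le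
    · have : (((W.δ₀ : ℚ) / (W.N x) : ℚ) : ℝ) = (W.δ₀ : ℝ) / (W.N x) := by push_cast; rfl
      rw [this]; exact hΔ
    · have : (((W.δ₀ : ℚ) / (W.N x) : ℚ) : ℝ) = (W.δ₀ : ℝ) / (W.N x) := by push_cast; rfl
      rw [this]; linarith
  -- membership
  unfold cands
  simp only [List.mem_flatMap, List.mem_range]
  refine ⟨u, hu, u', hu', ?_⟩
  unfold pairCands
  rw [if_pos ⟨hL, hLmin, hcpos⟩]
  exact List.mem_filter.2 ⟨List.mem_map.2 ⟨p, hp, rfl⟩, hkeep⟩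

/-- **The answer is `⌊R⌋` or `⌈R⌉`** when some listed candidate is within `1` of `NR` (and every
listed candidate is sound, which `keep_sound` guarantees): the least candidate `s⋆` has
`R − τ ≤ s⋆/N < R + 1/N`, so `m = ⌊s⋆/N + 1/4⌋ ∈ {⌊R⌋, ⌈R⌉}`.
[cite: Jozsa2003, §10 (c), §3 Prop. 2] [cite: Hallgren2007, §4] -/
theorem result_eq_floor_or_ceil (C : GiantStepCycle ι) {x y : List Bool} (hC : C.toWalkData = O.toWalkData (W.dOf x))
    (hN16 : 16 ≤ (W.N x)) (hτ : tol C W x < 1 / 16)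
    (hex : ∃ sc ∈ cands q O W x y, |(sc : ℝ) - (W.N x) * C.R| < 1) :
    result q O W x y = ⌊C.R⌋₊ ∨ result q O W x y = ⌈C.R⌉₊ := by
  obtain ⟨sc₀, hsc₀, hclose⟩ := hex
  have hN : 0 < (W.N x) := by omega
  have hNr : (0 : ℝ) < (W.N x) := by exact_mod_cast hN
  have hne : cands q O W x y ≠ [] := List.ne_nil_of_mem hsc₀
  set s := listMin (cands q O W x y) with hsdef
  have hsmem : s ∈ cands q O W x y := listMin_mem hne
  have hsle : s ≤ sc₀ := listMin_le hsc₀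
  -- soundness of `s`
  obtain ⟨h8, l, hl, hl1⟩ := keep_sound C hC hN (mem_cands_keep q hsmem)
  have hs8 : ((W.N x) : ℝ) / 8 - 1 ≤ s := by
    have h' : ((((W.N x) : ℤ) / 8 : ℤ) : ℝ) * 8 ≥ ((W.N x) : ℝ) - 8 := by
      have := Int.lt_ediv_add_one_mul_self ((W.N x) : ℤ) (by norm_num : (0 : ℤ) < 8)
      have : (((W.N x) : ℤ) : ℝ) < (((((W.N x) : ℤ) / 8 : ℤ) : ℝ) + 1) * 8 := by exact_mod_cast this
      push_cast at this; linarith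
    have : ((((W.N x) : ℤ) / 8 : ℤ) : ℝ) ≤ s := by exact_mod_cast h8
    linarith
  have hsN : tol C W x < (s : ℝ) / (W.N x) := by
    rw [lt_div_iff₀ hNr]
    have : (1 : ℝ) / 16 * (W.N x) ≤ ((W.N x) : ℝ) / 8 - 1 := by
      have : (16 : ℝ) ≤ (W.N x) := by exact_mod_cast hN16
      linarith
    calc tol C W x * (W.N x) < 1 / 16 * (W.N x) := mul_lt_mul_of_pos_right hτ hNr
      _ ≤ s := this.trans hs8
  have hl1' : (1 : ℤ) ≤ l := hl1 hsN
  have htol0 : 0 ≤ tol C W x := by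
    unfold tol
    have := C.Efin_nonneg (W.s₀ x) (W.T x) (2 * W.M x)
    have := C.η_nonneg
    positivity
  have hRpos := C.R_pos
  -- `R − τ ≤ s/N < R + 1/N`
  have hlow : C.R - tol C W x ≤ (s : ℝ) / (W.N x) := by
    rw [abs_le] at hl
    have : (1 : ℝ) * C.R ≤ l * C.R := by
      have : (1 : ℝ) ≤ l := by exact_mod_cast hl1'
      nlinarith
    linarith [hl.1]
  have hup : (s : ℝ) < (W.N x) * C.R + 1 := by
    have : (s : ℝ) ≤ sc₀ := by exact_mod_cast hsle
    rw [abs_lt] at hclose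
    linarith [hclose.2]
  -- the integer `m`
  have hres : result q O W x y = ((4 * s + (W.N x)) / (4 * (W.N x))).toNat := by
    unfold result; rw [if_neg hne]
  set m : ℤ := (4 * s + (W.N x)) / (4 * (W.N x)) with hmdef
  have h4N : (0 : ℤ) < 4 * (W.N x) := by have : 0 < (W.N x) := hN; omega
  have hm_lo : ⌊C.R⌋ ≤ m := by
    rw [hmdef, Int.le_ediv_iff_mul_le h4N]
    have hfl : (⌊C.R⌋ : ℝ) ≤ C.R := Int.floor_le _
    have : (⌊C.R⌋ : ℝ) * (4 * (W.N x)) ≤ 4 * s + (W.N x) := by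
      have : (C.R - tol C W x) * (W.N x) ≤ s := (le_div_iff₀ hNr).mp hlow
      nlinarith
    exact_mod_cast this
  have hm_hi : m ≤ ⌈C.R⌉ := by
    rw [hmdef, ← Int.lt_add_one_iff, Int.ediv_lt_iff_lt_mul h4N]
    have hce : C.R ≤ (⌈C.R⌉ : ℝ) := Int.le_ceil _
    have : (4 : ℝ) * s + (W.N x) < (⌈C.R⌉ + 1 : ℝ) * (4 * (W.N x)) := by
      have : (16 : ℝ) ≤ (W.N x) := by exact_mod_cast hN16
      nlinarith
    exact_mod_cast this
  have hm0 : 0 ≤ m := (Int.floor_nonneg.mpr hRpos.le).trans hm_lo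
  -- conclude in `ℤ`
  have hresZ : (result q O W x y : ℤ) = m := by rw [hres, Int.toNat_of_nonneg hm0]
  have hceil_le : ⌈C.R⌉ ≤ ⌊C.R⌋ + 1 := Int.ceil_le_floor_add_one _
  have hfl0 : (⌊C.R⌋₊ : ℤ) = ⌊C.R⌋ := Int.natCast_floor_eq_floor hRpos.le
  have hce0 : (⌈C.R⌉₊ : ℤ) = ⌈C.R⌉ := Int.natCast_ceil_eq_ceil hRpos.le
  rcases lt_or_eq_of_le hm_lo with hlt | heq
  · right
    have : m = ⌈C.R⌉ := le_antisymm hm_hi (by omega)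
    exact_mod_cast (show (result q O W x y : ℤ) = (⌈C.R⌉₊ : ℤ) by rw [hresZ, hce0, this])
  · left
    exact_mod_cast (show (result q O W x y : ℤ) = (⌊C.R⌋₊ : ℤ) by rw [hresZ, hfl0, heq])

end HallgrenPost

end Literature.Computability.Cryptography

end
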